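import Summits.Ventures.WeilGRH.UniformConductorFloorGalerkinWitness
import HarnessLib

/-!
# GRH arm (rh-explicit, venture WeilGRH): TABLE-BASED multi-mode (Galerkin) refutations — the cheap variant of `galerkinCheckHalfLog` on a certified
  special-value table

Cell `rh-explicit`, WEIL TRACK — GRH ARM (weil-grh-1, gen9).  `UniformConductorFloorGalerkinWitness.lean` refutes `WeilPositivityOnChar χ a` by an even integer
Galerkin vector with the records of the modes `0 … K` computed INSIDE the `decide` (≈ 2–4 s per record in the kernel, so `K ≤ 28` within the check lane).  Once a
certified table at the window exists (`UniformConductorFloorLog8HalfTable.lean` / `…Log9Table.lean`: `TabValid (2^80) a ks 160 tab`), the records are literal data and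
only the `(2K+1)(K+1)` entry boxes remain: this file's `galerkinCheckTab` (same `pairBox` / `symSum` evaluator, table and constants as arguments) with soundness
`not_weilPositivityOnChar_of_galerkinCheckTab` — for razor moduli whose refutation needs `K ≫ 28` (next rungs: `167` at `(log 10)/2`, `277` at `(log 12)/2`, …).
Computable `def` with docstring; RH/GRH-free; standard axioms; no named facts.

## References

* H. Yoshida, *On Hermitian forms attached to zeta functions*, Adv. Stud. Pure Math. 21 (1992) 281–325, §5 (5.15)/(5.16) p. 301. [Yoshida1992HermitianForms]
* R. E. Moore, *Interval Analysis* (1966), Ch. 3. [Moore1966]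
-/

set_option autoImplicit false

open Real Complex Finset
open scoped BigOperators ArithmeticFunction.vonMangoldt ComplexConjugate

namespace Summit.Ventures.WeilGRH

open Literature.NumberTheory.LFunctions Literature.NumberTheory.LFunctions.Yoshida1992
open Literature.NumberTheory.LFunctions.Yoshida1992.Encl
open Literature.Analysis.SpecialFunctions Literature.Analysis.ValidatedNumerics.NumericsMP
open TwistedEncl

namespace UniformFloor

variable {q : ℕ}

/-- **The table-based Galerkin check**: given window constants `C`, a special-value table `tab` (modes `0 … K` at least), `LQ ∋ log q`, prime signs `εs` and
even integer coefficients `cs`, test that the boxed quadratic form `Σ_{n,m∈[−K,K]} c_n c_m G(n,m)` has negative upper end.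
[cite: Moore1966, Ch. 3 (interval arithmetic: inclusion property)] -/
def galerkinCheckTab (S : ℕ) (C : Consts) (tab : List IdxRec) (LQ : MI) (εs cs : List ℤ) (K : ℕ) : Bool :=
  decide ((symSum S (pairBox S C εs LQ tab) cs K (2 * K + 1)).hi < 0)

/-- ★ **Soundness of the table-based Galerkin check**: valid prime data / constants / table below `N > K` / `LQ ∋ log q`, and `galerkinCheckTab … = true` ⇒
every real even character `χ` mod `q ≠ 1` with prime signs `εs` FAILS `WeilPositivityOnChar χ a` (witness `f = Σ_{|n| ≤ K} cs[|n|]·χ_n`).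
[cite: Yoshida1992HermitianForms, §5 (5.15)-(5.16) p. 301; Moore1966, Ch. 3 (interval arithmetic: inclusion property)] -/
theorem not_weilPositivityOnChar_of_galerkinCheckTab {S : ℕ} (hS : 0 < S) {a : ℝ} (ha0 : 0 < a) {ks : List PrimeLen} (hks : PrimeData a ks)
    {C : Consts} (hC : ConstsValid S a ks C) {N K : ℕ} {tab : List IdxRec} (htab : TabValid S a ks N tab) (hKN : K < N)
    {LQ : MI} (hLQ : MI.mem S (Real.log q) LQ) {εs cs : List ℤ} (h : galerkinCheckTab S C tab LQ εs cs K = true)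
    (hq : q ≠ 1) (χ : DirichletCharacter ℂ q) (hreal : ∀ n : ℕ, conj (χ (n : ZMod q)) = χ (n : ZMod q)) (heven : charParity χ = 0)
    (hε : ∀ i < ks.length, (χ (((ks.getD i default).val : ℕ) : ZMod q)).re = ((εs.getD i 0 : ℤ) : ℝ)) :
    ¬ WeilPositivityOnChar χ a := by
  unfold galerkinCheckTab at h
  rw [decide_eq_true_eq] at h
  have htab' : TabValid S a ks (K + 1) tab := fun n hn ↦ htab n (by omega)
  have hform : MI.mem S (∑ i ∈ Finset.range (2 * K + 1), ∑ j ∈ Finset.range (2 * K + 1),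
      (coef cs ((i : ℤ) - K) : ℝ) * (coef cs ((j : ℤ) - K) : ℝ) * twistedGramCoeff χ a ((i : ℤ) - K) ((j : ℤ) - K))
      (symSum S (pairBox S C εs LQ tab) cs K (2 * K + 1)) :=
    mem_symSum (K := K) _ (fun n m ↦ twistedGramCoeff χ a n m) (fun n m ↦ twistedGramCoeff_comm χ _ n m) cs
      (fun i hi j hj ↦ mem_pairBox hS ha0 hks hC χ hε hLQ htab' (by omega) (by omega)) _ le_rfl
  have hneg := MI.neg_of_hi_neg hform h
  refine not_weilPositivityOnChar_of_twistedWindowForm_sum_chi_neg hq χ ha0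
    (s := (Finset.range (2 * K + 1)).image (fun i : ℕ ↦ (i : ℤ) - K)) (c := fun n ↦ ((coef cs n : ℤ) : ℂ)) ?_
  rw [twistedWindowForm_sum_smul_chi_eq_twistedGramCoeff χ hreal heven ha0]
  simp_rw [re_conj_intCast_mul_intCast]
  rw [sum_sum_image_shift K]
  exact hneg

end UniformFloor

end Summit.Ventures.WeilGRH
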